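import Summits.BirchSwinnertonDyer.BirchSwinnertonDyer.Theorems.CyclotomicUntwistStabilisedTwistOldforms
import Summits.BirchSwinnertonDyer.BirchSwinnertonDyer.Theorems.CyclotomicUntwistStabilisedTwistQExpansion
import HarnessLib

/-!
# C1 `PSUntwistedLFunctionAtThree` from PRINT and a UNIFORM ROOT LAW — the stabilised-twist statement
# (★q) discharged up to «a₃ of every newform of `f_W ⊗ η̄` is one root `α` of `X² − a_w X + 3`»
# (route `CyclotomicUntwist`, child C1; no Atkin–Li named fact, no strong multiplicity one)

Cell `pub/bsd-wall` (D-0145 line `route-BirchSwinnertonDyer-CyclotomicUntwist`), width seat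
`bsd-line-cycu-p4` (gen 12). THEOREMS ONLY (no definition, no named fact, no `sorry`); helper
`--supports stmt-BirchSwinnertonDyer-27548`. BSD is not proved by this file; C1 is NOT closed by it
(it stays conditional on the uniform root law below and on print); K1/K2 stay OPEN and WHOLE.

Sibling `bsd-line-cycu-p3` (gen 9) proved `psUntwistedLFunctionAtThree_of_print_of_qExpansion`:
C1 VERBATIM from PRINT (modularity, Carayol's level, Gross–Zagier I.(7.3), GZK) and (★q) = «on every
principal-series row, for SOME primitive `η_K` mod `9` and SOME root `α_K` of `X² − a_w(W)X + 3`, SOME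
weight-2 cusp form `G` on SOME `Γ₁(L)` has `aₙ(G) − ι(α_K)𝟙_{3∣n}a_{n/3}(G) = κ·ι(η̄_K(n))·g·aₙ(f_W)`».
With `PSStabilisedTwistOldforms.exists_stabilisedOldform_of_twist` (the stabilised oldform factorisation
of the twist, proved without strong multiplicity one) the modular-forms half of (★q) is discharged, and
what remains is the UNIFORM ROOT LAW (ULaw): «on every principal-series row, for the newform `f` of `W`,
there are a primitive `η_K` mod `9` with `η_K² ≠ 1` and a root `α_K ∈ K` of `X² − a_w(W)X + 3` such that
EVERY newform `g` (level `M₀ ∣ 81N`) carrying the eigenpacket of `f ⊗ (ι∘η_K)⁻¹` off `3N` has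
`a₃(g) = ι(α_K)`» — the Galois-side statement (Deligne's `ρ_g`, Carayol (A) at `p = 3`, inertia of
`V_ℓ(E)` at `3` through `Gal(ℚ₃(ζ₉)/ℚ₃)`; lane 2 of the K1 lead), uniform in `g` because the Euler factor
`det(1 − Frob₃ T ∣ (V_ℓ(E) ⊗ ψ_{η̄})_{I₃})` does not mention `g`.

* `ringHomComp_sq_ne_one` — `η_K² ≠ 1 ⟹ (ι∘η_K)² ≠ 1` (`ι` injective).
* `psUntwistedLFunctionAtThree_of_print_of_uniformRootLaw : hmod → hlev → GZ86 → GZK → ULaw →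
  PSUntwistedLFunctionAtThree`.

References: [cite: MazurTateTeitelbaum1986Invent, §I.14] · [cite: AtkinLi1978, §3] ·
[cite: Carayol1986, Thm. (A)] · [cite: GrossZagier1986, Thm. I.(7.3)] · [cite: DiamondShurman2005, Thm. 5.8.3].
-/

noncomputable section

open scoped MatrixGroups

open CongruenceSubgroup UpperHalfPlane
  Literature.NumberTheory.EllipticCurves Literature.NumberTheory.EllipticCurves.ModularForms
  Literature.NumberTheory.EllipticCurves.Rank1Residual Literature.NumberTheory.IwasawaTheory
  Summit.BirchSwinnertonDyer.BirchSwinnertonDyer.Theses.CyclotomicUntwist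

-- single-conjunct summit: `Summit.BirchSwinnertonDyer.BirchSwinnertonDyer.…` repeats the name by design
set_option linter.dupNamespace false
set_option autoImplicit false

namespace Summit.BirchSwinnertonDyer.BirchSwinnertonDyer.Theorems.PSStabilisedTwistOldformsC1

variable {K : Type*} [Field K] (ιp : K →+* ℂ_[3]) (ι : K →+* ℂ)

/-- Composition with an (injective) field homomorphism reflects `χ² = 1`: if `η_K² ≠ 1` then
`(ι ∘ η_K)² ≠ 1`. [folklore] -/
theorem ringHomComp_sq_ne_one {n : ℕ} {χ : DirichletCharacter K n} (hχ : χ ^ 2 ≠ 1) :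
    (χ.ringHomComp ι) ^ 2 ≠ 1 := by
  intro h
  apply hχ
  refine MulChar.ext fun u ↦ ?_
  have hu := congrArg (fun ψ : DirichletCharacter ℂ n ↦ ψ (u : ZMod n)) h
  simp only [MulChar.pow_apply' _ two_ne_zero, MulChar.ringHomComp_apply, MulChar.one_apply_coe] at hu
  rw [MulChar.pow_apply' _ two_ne_zero, MulChar.one_apply_coe]
  apply ι.injective
  rw [map_pow, map_one]
  exact hu

include ιp in
/-- **C1 `PSUntwistedLFunctionAtThree` FROM PRINT AND THE UNIFORM ROOT LAW.** PRINT = modularity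
(`nonempty_modularParametrizationData`), Carayol's «level = conductor» (`IsNewformOf.level_eq_conductorNorm`),
Gross–Zagier I.(7.3) (`GrossZagier1986_thm_I_7_3`), Gross–Zagier–Kolyvagin (`PublishedInputGZK`). ULaw
(hypothesis `hU`) = on every principal-series row, for the newform `f` of `W`: some primitive `η_K` mod `9`
with `η_K² ≠ 1` and some root `α_K ∈ K` of `X² − a_w(W)X + 3` such that EVERY newform `g` of level
`M₀ ∣ 81N` with `a_ℓ(g) = (ι∘η_K)⁻¹(ℓ) a_ℓ(f)` and `ε_g(ℓ) = (ι∘η_K)⁻¹(ℓ)²` for the primes `ℓ ∤ 9N` has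
`a₃(g) = ι(α_K)`. Then C1 holds VERBATIM: the stabilised oldform factorisation
(`exists_stabilisedOldform_of_twist`, level `81N`, `κ = 1`) supplies (★q), and cycu-p3's
`psUntwistedLFunctionAtThree_of_print_of_qExpansion` concludes. No Atkin–Li named fact and no strong
multiplicity one on `Γ₁` are used. [cite: MazurTateTeitelbaum1986Invent, §I.14] [cite: AtkinLi1978, §3]
[cite: Carayol1986, Thm. (A)] [cite: GrossZagier1986, Thm. I.(7.3)] -/
theorem psUntwistedLFunctionAtThree_of_print_of_uniformRootLaw
    (hmod : nonempty_modularParametrizationData)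
    (hlev : ∀ (N : ℕ) [NeZero N], IsNewformOf.level_eq_conductorNorm (N := N))
    (hGZ86 : GrossZagier1986_thm_I_7_3) (hGZK : PublishedInputGZK)
    (hU : ∀ (W : WeierstrassCurve ℚ) [W.IsElliptic] [W.IsGloballyMinimal], ¬ W.HasCM →
      Summit.BirchSwinnertonDyer.Rank1Residual.Additive.ClassO6 W 3 → Surj W 3 →
      Even (padicValInt 3 W.minimalDiscriminantInt) →
      W.minimalDiscriminantInt / 3 ^ padicValInt 3 W.minimalDiscriminantInt % 3 = 1 →
      W.analyticRank = 1 →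
      ∀ {N : ℕ} [NeZero N] (f : CuspForm (Gamma0 N) 2), IsNewformOf W f →
      ∃ (ηK : DirichletCharacter K (3 ^ 2)) (αK : K), ηK.IsPrimitive ∧ ηK ^ 2 ≠ 1 ∧
        αK ^ 2 - ((W.psUntwistedTrace : ℤ) : K) * αK + 3 = 0 ∧
        ∀ (M₀ : ℕ) [NeZero M₀] (g : CuspForm (Gamma1 M₀) 2), IsNewform1 g → M₀ ∣ N * (3 ^ 2) ^ 2 →
          (∀ ℓ : ℕ, ℓ.Prime → ¬ ℓ ∣ N * 3 ^ 2 →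
            cuspCoeff g ℓ = (ηK.ringHomComp ι)⁻¹ (ℓ : ZMod (3 ^ 2)) * cuspCoeff f ℓ ∧
              nebentypus g (ℓ : ZMod M₀) = (ηK.ringHomComp ι)⁻¹ (ℓ : ZMod (3 ^ 2)) ^ 2) →
          cuspCoeff g 3 = ι αK) :
    PSUntwistedLFunctionAtThree := by
  refine PSStabilisedTwistQExpansion.psUntwistedLFunctionAtThree_of_print_of_qExpansion ιp ι hmod hlev
    hGZ86 hGZK fun W _ _ hCM hO6 hsurj hev hsq hr N _ f hf ↦ ?_
  obtain ⟨ηK, αK, hη, hη2, hroot, hunif⟩ := hU W hCM hO6 hsurj hev hsq hr f hf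
  have hηC : DirichletCharacter.IsPrimitive (ηK.ringHomComp ι) :=
    (Literature.NumberTheory.EllipticCurves.isPrimitive_ringHomComp_iff ι ηK).mpr hη
  haveI : NeZero (3 ^ 2) := ⟨by norm_num⟩
  haveI : NeZero (N * (3 ^ 2) ^ 2) := ⟨mul_ne_zero (NeZero.ne N) (by norm_num)⟩
  obtain ⟨G, hG⟩ := PSStabilisedTwistOldforms.exists_stabilisedOldform_of_twist (p := 3) (c := 2) hf.1
    hηC (ringHomComp_sq_ne_one ι hη2) Nat.prime_three two_ne_zero (ι αK) hunif
  refine ⟨ηK, αK, N * (3 ^ 2) ^ 2, inferInstance, G, 1, hη, hroot, one_ne_zero, fun n ↦ ?_⟩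
  rw [hG n, one_mul]

end Summit.BirchSwinnertonDyer.BirchSwinnertonDyer.Theorems.PSStabilisedTwistOldformsC1

end
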